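import Mathlib.Data.Finset.Card
import Mathlib.Data.Finset.Image
import Mathlib.Data.Nat.Bitwise
import HarnessLib

/-!
# ω-census, family (b3): a kernel checker for "no independent set of `k` vertices" (first-fit clique-partition bound)

HONEST FRAMING (pub-omega census; verbatim): lottery ticket; floor = certified bounds/negative ranges.
Census BOOKKEEPING machinery — a Boolean checker and its soundness; no value of `ω` is touched here.

Purpose.  The box bound of `ProductBoxBound.lean` (`box_bound`: a TPP triple of `Q × A`, `A` finite abelian, has
`|S||T||U| ≤ k·|A|` as soon as every INDEPENDENT set of cells inside the box of `Q`-projections has at most `k` elements)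
turns a census cell into a finite statement about a small graph: the cells of the box are the vertices, two cells are joined
when one of the two ordered cell words is trivial, and `k` is an upper bound for the size of an independent set.  This file is
the graph-theoretic half, on plain naturals for kernel speed: vertices are naturals, the neighbourhood of `a` is the bit mask
`adj a`, vertex sets are bit masks / `Finset ℕ`.

* `noIndep adj vs cand k` — branch and bound over the listed vertices `vs` (in list order) that lie in the mask `cand`:
  skip a vertex outside `cand`; otherwise prune when the FIRST-FIT CLIQUE PARTITION of the remaining candidates
  (`ffCount`: each vertex joins the first block all of whose members are flagged neighbours of it, else opens a block) has
  fewer than `k` blocks; otherwise branch "vertex in the set" (candidates shrink to the non-neighbours, `k - 1` to go) and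
  "vertex not in the set".
* `card_lt_of_noIndep` — soundness: if the checker answers `true`, every `adj`-independent `I ⊆ {v ∈ vs | v ∈ cand}` has
  `#I < k` (`IndepN adj I`: distinct members `a, b` have bit `b` of `adj a` clear).  The bound step is `card_le_ffCount`
  (an independent set meets a block — a clique in the weak sense `WeakClique` — at most once).
* `IndepN.image` — transport of independent sets along an injection that reflects flagged adjacency (used to move a bound
  between isomorphic boxes).

Instances (the `S₃` boxes of the census) live in `S3BoxIndependence.lean`.  Nothing here is specific to groups.
-/

namespace Summit.MatrixMultiplication.OmegaCensus.IndepSearch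

/-! ## The checker -/

/-- First-fit insertion of vertex `v`: join the first block `B` with `B ⊆ adj v` (as masks), else open the block `{v}`.
[folklore] -/
def ffInsert (adj : ℕ → ℕ) (v : ℕ) : List ℕ → List ℕ
  | [] => [2 ^ v]
  | B :: Bs => if B &&& adj v == B then (B ||| 2 ^ v) :: Bs else B :: ffInsert adj v Bs

/-- First-fit clique partition of the listed vertices lying in `cand`, starting from the blocks `blocks`. [folklore] -/
def ffBlocks (adj : ℕ → ℕ) (cand : ℕ) : List ℕ → List ℕ → List ℕ
  | [], blocks => blocks
  | v :: vs, blocks => ffBlocks adj cand vs (if cand.testBit v then ffInsert adj v blocks else blocks)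

/-- Number of blocks of the first-fit clique partition: an upper bound for the size of an independent set of listed
vertices inside `cand` (`card_le_ffCount`). [folklore] -/
def ffCount (adj : ℕ → ℕ) (cand : ℕ) (vs : List ℕ) : ℕ := (ffBlocks adj cand vs []).length

/-- **The checker.** `noIndep adj vs cand k = true` certifies: no `adj`-independent set of `k` listed vertices inside the
mask `cand` (`card_lt_of_noIndep`).  Branch and bound in list order with the first-fit clique-partition bound. [folklore] -/
def noIndep (adj : ℕ → ℕ) : List ℕ → ℕ → ℕ → Bool
  | _, _, 0 => false
  | [], _, _ + 1 => true
  | v :: vs, cand, k + 1 =>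
      if cand.testBit v then
        decide (ffCount adj cand (v :: vs) < k + 1) ||
          (noIndep adj vs (cand.ldiff (adj v)) k && noIndep adj vs cand (k + 1))
      else noIndep adj vs cand (k + 1)

/-! ## Semantics -/

/-- `I` is independent for the adjacency masks `adj`: for distinct members `a, b` the bit `b` of `adj a` is clear (both orders,
as both are members). [folklore] -/
def IndepN (adj : ℕ → ℕ) (I : Finset ℕ) : Prop := ∀ a ∈ I, ∀ b ∈ I, a ≠ b → (adj a).testBit b = false

/-- A block is a clique in the weak sense: two distinct members are flagged adjacent in at least one order. [folklore] -/
def WeakClique (adj : ℕ → ℕ) (B : ℕ) : Prop :=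
  ∀ a b : ℕ, B.testBit a = true → B.testBit b = true → a ≠ b → (adj a).testBit b = true ∨ (adj b).testBit a = true

/-- An independent set meets a weak clique in at most one vertex. [folklore] -/
theorem IndepN.card_filter_le_one {adj : ℕ → ℕ} {I : Finset ℕ} (hI : IndepN adj I) {B : ℕ} (hB : WeakClique adj B) :
    (I.filter fun a => B.testBit a = true).card ≤ 1 := by
  rw [Finset.card_le_one]
  intro a ha b hb
  rw [Finset.mem_filter] at ha hb
  by_contra hne
  rcases hB a b ha.2 hb.2 hne with h | h
  · rw [hI a ha.1 b hb.1 hne] at h; exact Bool.false_ne_true h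
  · rw [hI b hb.1 a ha.1 (Ne.symm hne)] at h; exact Bool.false_ne_true h

/-- Counting against a list of weak cliques: an independent set covered by the blocks has at most as many elements as there
are blocks. [folklore] -/
theorem IndepN.card_le_length {adj : ℕ → ℕ} {I : Finset ℕ} (hI : IndepN adj I) :
    ∀ L : List ℕ, (∀ B ∈ L, WeakClique adj B) → (∀ a ∈ I, ∃ B ∈ L, B.testBit a = true) → I.card ≤ L.length
  | [], _, hcov => by
      have : I = ∅ := Finset.eq_empty_of_forall_notMem fun a ha => by
        obtain ⟨B, hB, -⟩ := hcov a ha; simp at hB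
      simp [this]
  | B :: L, hcl, hcov => by
      classical
      have hsplit := Finset.card_filter_add_card_filter_not (s := I) (fun a => B.testBit a = true)
      have h1 : (I.filter fun a => B.testBit a = true).card ≤ 1 :=
        hI.card_filter_le_one (hcl B (by simp))
      have hI' : IndepN adj (I.filter fun a => ¬ B.testBit a = true) := fun a ha b hb hab =>
        hI a (Finset.mem_filter.1 ha).1 b (Finset.mem_filter.1 hb).1 hab
      have h2 : (I.filter fun a => ¬ B.testBit a = true).card ≤ L.length := by
        refine hI'.card_le_length L (fun B' hB' => hcl B' (by simp [hB'])) fun a ha => ?_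
        rw [Finset.mem_filter] at ha
        obtain ⟨B', hB', ha'⟩ := hcov a ha.1
        rcases List.mem_cons.1 hB' with rfl | hB'
        · exact absurd ha' ha.2
        · exact ⟨B', hB', ha'⟩
      simp only [List.length_cons]
      omega

/-! ## The first-fit partition: blocks are weak cliques and cover the inserted vertices -/

/-- From `B &&& A = B`: every member of `B` is a member of `A`. [folklore] -/
theorem testBit_of_land_eq {B A b : ℕ} (h : B &&& A = B) (hb : B.testBit b = true) : A.testBit b = true := by
  have := congrArg (fun x => x.testBit b) h
  simp only [Nat.testBit_land, hb, Bool.true_and] at this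
  exact this

/-- `ffInsert` keeps all blocks weak cliques. [folklore] -/
theorem ffInsert_clique (adj : ℕ → ℕ) (v : ℕ) :
    ∀ blocks : List ℕ, (∀ B ∈ blocks, WeakClique adj B) → ∀ B ∈ ffInsert adj v blocks, WeakClique adj B
  | [], _, B, hB => by
      simp only [ffInsert, List.mem_singleton] at hB
      subst hB
      intro a b ha hb hab
      rw [Nat.testBit_two_pow] at ha hb
      simp only [decide_eq_true_eq] at ha hb
      omega
  | B₀ :: Bs, hcl, B, hB => by
      simp only [ffInsert] at hB
      split_ifs at hB with hsub
      · rcases List.mem_cons.1 hB with rfl | hB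
        · have hsub' : B₀ &&& adj v = B₀ := by simpa using hsub
          have h0 := hcl B₀ (by simp)
          intro a b ha hb hab
          rw [Nat.testBit_lor, Bool.or_eq_true, Nat.testBit_two_pow] at ha hb
          simp only [decide_eq_true_eq] at ha hb
          rcases ha with ha | rfl <;> rcases hb with hb | rfl
          · exact h0 a b ha hb hab
          · exact Or.inr (testBit_of_land_eq hsub' ha)
          · exact Or.inl (testBit_of_land_eq hsub' hb)
          · exact absurd rfl hab
        · exact hcl B (by simp [hB])
      · rcases List.mem_cons.1 hB with rfl | hB
        · exact hcl _ (by simp)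
        · exact ffInsert_clique adj v Bs (fun B' hB' => hcl B' (by simp [hB'])) B hB

/-- `ffInsert` covers `v` and keeps covering what was covered. [folklore] -/
theorem ffInsert_cover (adj : ℕ → ℕ) (v : ℕ) :
    ∀ (blocks : List ℕ) (a : ℕ), (a = v ∨ ∃ B ∈ blocks, B.testBit a = true) →
      ∃ B ∈ ffInsert adj v blocks, B.testBit a = true
  | [], a, h => by
      rcases h with rfl | ⟨B, hB, -⟩
      · exact ⟨2 ^ a, by simp [ffInsert], by rw [Nat.testBit_two_pow]; simp⟩
      · simp at hB
  | B₀ :: Bs, a, h => by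
      simp only [ffInsert]
      split_ifs with hsub
      · rcases h with rfl | ⟨B, hB, hBa⟩
        · exact ⟨B₀ ||| 2 ^ a, by simp, by rw [Nat.testBit_lor, Nat.testBit_two_pow]; simp⟩
        · rcases List.mem_cons.1 hB with rfl | hB
          · exact ⟨B ||| 2 ^ v, by simp, by rw [Nat.testBit_lor, hBa]; simp⟩
          · exact ⟨B, by simp [hB], hBa⟩
      · rcases h with rfl | ⟨B, hB, hBa⟩
        · obtain ⟨B, hB, hBa⟩ := ffInsert_cover adj a Bs a (Or.inl rfl)
          exact ⟨B, by simp [hB], hBa⟩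
        · rcases List.mem_cons.1 hB with rfl | hB
          · exact ⟨B, by simp, hBa⟩
          · obtain ⟨B', hB', hBa'⟩ := ffInsert_cover adj v Bs a (Or.inr ⟨B, hB, hBa⟩)
            exact ⟨B', by simp [hB'], hBa'⟩

/-- `ffBlocks` keeps all blocks weak cliques. [folklore] -/
theorem ffBlocks_clique (adj : ℕ → ℕ) (cand : ℕ) :
    ∀ (vs blocks : List ℕ), (∀ B ∈ blocks, WeakClique adj B) → ∀ B ∈ ffBlocks adj cand vs blocks, WeakClique adj B
  | [], _, hcl => by simpa [ffBlocks] using hcl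
  | v :: vs, blocks, hcl => by
      simp only [ffBlocks]
      refine ffBlocks_clique adj cand vs _ ?_
      split_ifs
      · exact ffInsert_clique adj v blocks hcl
      · exact hcl

/-- `ffBlocks` covers every listed vertex of `cand` and everything the initial blocks covered. [folklore] -/
theorem ffBlocks_cover (adj : ℕ → ℕ) (cand : ℕ) :
    ∀ (vs blocks : List ℕ) (a : ℕ), ((a ∈ vs ∧ cand.testBit a = true) ∨ ∃ B ∈ blocks, B.testBit a = true) →
      ∃ B ∈ ffBlocks adj cand vs blocks, B.testBit a = true
  | [], _, a, h => by
      rcases h with ⟨h, -⟩ | h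
      · simp at h
      · simpa [ffBlocks] using h
  | v :: vs, blocks, a, h => by
      simp only [ffBlocks]
      refine ffBlocks_cover adj cand vs _ a ?_
      rcases h with ⟨hmem, hc⟩ | ⟨B, hB, hBa⟩
      · rcases List.mem_cons.1 hmem with rfl | hmem
        · rw [if_pos hc]
          exact Or.inr (ffInsert_cover adj a blocks a (Or.inl rfl))
        · exact Or.inl ⟨hmem, hc⟩
      · right
        split_ifs
        · exact ffInsert_cover adj v blocks a (Or.inr ⟨B, hB, hBa⟩)
        · exact ⟨B, hB, hBa⟩

/-- **The bound**: an independent set of listed vertices inside `cand` has at most `ffCount adj cand vs` elements. [folklore] -/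
theorem card_le_ffCount {adj : ℕ → ℕ} {I : Finset ℕ} (hI : IndepN adj I) {cand : ℕ} {vs : List ℕ}
    (hsub : ∀ a ∈ I, a ∈ vs ∧ cand.testBit a = true) : I.card ≤ ffCount adj cand vs :=
  hI.card_le_length _ (ffBlocks_clique adj cand vs [] (by simp)) fun a ha =>
    ffBlocks_cover adj cand vs [] a (Or.inl (hsub a ha))

/-! ## Soundness of the checker -/

/-- **Soundness.** If `noIndep adj vs cand k = true` then every `adj`-independent set of listed vertices inside `cand` has
fewer than `k` elements. [folklore] -/
theorem card_lt_of_noIndep (adj : ℕ → ℕ) :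
    ∀ (vs : List ℕ) (cand k : ℕ), noIndep adj vs cand k = true →
      ∀ I : Finset ℕ, IndepN adj I → (∀ a ∈ I, a ∈ vs ∧ cand.testBit a = true) → I.card < k
  | vs, cand, 0, h, _, _, _ => by cases vs <;> simp [noIndep] at h
  | [], cand, k + 1, _, I, _, hsub => by
      have : I = ∅ := Finset.eq_empty_of_forall_notMem fun a ha => by simpa using (hsub a ha).1
      simp [this]
  | v :: vs, cand, k + 1, h, I, hI, hsub => by
      classical
      simp only [noIndep] at h
      split_ifs at h with hv
      · simp only [Bool.or_eq_true, decide_eq_true_eq, Bool.and_eq_true] at h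
        rcases h with hbd | ⟨hin, hout⟩
        · exact lt_of_le_of_lt (card_le_ffCount hI hsub) hbd
        · by_cases hvI : v ∈ I
          · -- `v` in the set: the rest lies among the non-neighbours of `v`
            have hrest : (I.erase v).card < k := by
              refine card_lt_of_noIndep adj vs _ k hin (I.erase v) (fun a ha b hb hab =>
                hI a (Finset.mem_of_mem_erase ha) b (Finset.mem_of_mem_erase hb) hab) fun a ha => ?_
              have hav : a ≠ v := Finset.ne_of_mem_erase ha
              have haI := Finset.mem_of_mem_erase ha
              obtain ⟨hmem, hc⟩ := hsub a haI
              refine ⟨(List.mem_cons.1 hmem).resolve_left hav, ?_⟩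
              rw [Nat.testBit_ldiff, hc, hI v hvI a haI (Ne.symm hav)]; rfl
            have := Finset.card_erase_add_one hvI
            omega
          · exact card_lt_of_noIndep adj vs cand (k + 1) hout I hI fun a ha =>
              ⟨(List.mem_cons.1 (hsub a ha).1).resolve_left (fun e => hvI (e ▸ ha)), (hsub a ha).2⟩
      · refine card_lt_of_noIndep adj vs cand (k + 1) h I hI fun a ha => ⟨?_, (hsub a ha).2⟩
        rcases List.mem_cons.1 (hsub a ha).1 with rfl | hmem
        · exact absurd (hsub a ha).2 (by simp [hv])
        · exact hmem

/-- **Corollary (whole vertex range).** If `noIndep adj (List.range n) (2 ^ n - 1) k = true`, every `adj`-independent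
`I ⊆ range n` has `#I < k`. [folklore] -/
theorem card_lt_of_noIndep_range {adj : ℕ → ℕ} {n k : ℕ} (h : noIndep adj (List.range n) (2 ^ n - 1) k = true)
    (I : Finset ℕ) (hI : IndepN adj I) (hIn : ∀ a ∈ I, a < n) : I.card < k :=
  card_lt_of_noIndep adj _ _ k h I hI fun a ha =>
    ⟨List.mem_range.2 (hIn a ha), by rw [Nat.testBit_two_pow_sub_one]; simpa using hIn a ha⟩

/-! ## Transport along adjacency-reflecting injections -/

/-- The image of an independent set under a map that is injective on it and REFLECTS flagged adjacency is independent, of the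
same size. [folklore] -/
theorem IndepN.image {adj adj' : ℕ → ℕ} {I : Finset ℕ} (hI : IndepN adj I) (f : ℕ → ℕ) (hinj : Set.InjOn f I)
    (hrefl : ∀ a ∈ I, ∀ b ∈ I, a ≠ b → (adj' (f a)).testBit (f b) = true → (adj a).testBit b = true) :
    IndepN adj' (I.image f) ∧ (I.image f).card = I.card := by
  classical
  refine ⟨fun x hx y hy hxy => ?_, Finset.card_image_of_injOn hinj⟩
  obtain ⟨a, ha, rfl⟩ := Finset.mem_image.1 hx
  obtain ⟨b, hb, rfl⟩ := Finset.mem_image.1 hy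
  have hab : a ≠ b := fun e => hxy (by rw [e])
  cases h : (adj' (f a)).testBit (f b)
  · rfl
  · have := hrefl a ha b hb hab h
    rw [hI a ha b hb hab] at this
    exact absurd this (by simp)

end Summit.MatrixMultiplication.OmegaCensus.IndepSearch
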